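import Literature.Analysis.FluidPDE.LinearizedOseenWindow
import Literature.Analysis.FluidPDE.OseenDuhamelEnvelopeCalculus
import Literature.Analysis.ODE.LacunaryVolterraBounds
import HarnessLib

/-!
# The linearised Oseen problem with a LACUNARY singular coefficient: the dyadic layers and their
  Grönwall bounds (Coiculescu–Palasek, Prop. 4.2 in forcing form)

Analysis/FluidPDE support file (definitions of the dyadic bookkeeping — `dyadicTime`, `freeFrom`,
`layerFree`, `layerCoeff`, `layerSol`, `layerEnvelope`, `layerBound`, the hypothesis bundles
`LacunaryCoeff`, `ForcingPairs`, and the Grönwall constants — everything else proved) for the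
linear step, in FORCING form, of the perturbation theorem of M. P. Coiculescu, S. Palasek,
*Non-uniqueness of smooth solutions of the Navier–Stokes equations from critical data*, Invent.
Math. 244 (2025) = arXiv:2503.14699, Props. 4.2–4.3 (hypothesis `hB` of
`Literature.Barriers.NavierStokesRegularity.CriticalDataSmoothNonuniqueness_of_principalParts_of_perturbationThreshold`).

Setting. A coefficient field `v` on `(0, T] × E` with `‖v(τ)‖_∞ ≤ V(τ)`, `√τ V(τ) ≤ K₀`
((3.13a), `m = 0`) and the LACUNARITY `∫_{t₁}^{t₂} (V² + s^{-1/2}V) ≤ C(1 + η log(t₂/t₁))`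
((3.13b)) — `LacunaryCoeff`; a forcing given by finitely many pairs `(aᵢ, bᵢ)` of jointly
measurable fields with continuous envelopes `Aᵢ, Bᵢ` and `Σᵢ AᵢBᵢ ≤ N τ^{α-1}` (the weight of the
space `Y` of §4.2 in sup form: `‖F(τ)‖_∞ ≲ τ^{-1+α}`) — `ForcingPairs`. The free term from time `σ`
is `Φ_σ(t) = Σᵢ B_σ(aᵢ, bᵢ)(t)`. On the dyadic layers `(s_{n+1}, s_n]`, `s_n = T2^{-n}`, the layer
free term `Ψ_n = 𝟙_{(s_{n+1},T]}(Φ_{s_{n+1}} - Φ_{s_n})` is bounded by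
`φ_n(t) = C₀N ∫_{(s_{n+1}, t ∧ s_n)} (t-τ)^{-1/2}τ^{α-1} dτ` with `√t φ_n(t) ≤ 7C₀N s_{n+1}^α`
(`Literature.Analysis.ODE.sqrt_mul_setIntegral_layer_le`), and the layer solution
`w_n = linPicardLimit s_{n+1} T v Ψ_n` of `w = Ψ_n - B(v,w) - B(w,v)` obeys — by the majorant
domination of `LinearizedOseenWindow.lean`, the kernel comparison and the lacunary fractional
Grönwall inequality `Literature.Analysis.ODE.lacunary_gronwall_power` (Lemma B.3 + (3.13a,b)) —
the bound `‖w_n(t,x)‖ ≤ R_n(t) = C_* N s_{n+1}^α (t/s_{n+1})^{ε} t^{-1/2}` with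
`ε = Λ η`, `Λ = C_G (1 + 4C₀K₀)(4C₀²+2C₀)C`, `C_* = 7 C₀ C_G e^{Λ}` (`norm_layerSol_le`). This is
the content of Prop. 4.2 (first slot) of the paper, layer by layer; the resummation over the
layers (Prop. 4.3's `∫₀ᵗ (t')^{-1+α-ε}dt'`) is the sibling file `LinearizedOseenDyadicLimit`.

## References

* M. P. Coiculescu, S. Palasek, Invent. Math. 244 (2025) = arXiv:2503.14699: Prop. 3.13
  ((3.13a)–(3.13b)), §4.2 (space `Y`), Prop. 4.2 and its proof, App. B (Prop. B.1, Lemma B.3).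
  [`CoiculescuPalasek2025`]
-/

noncomputable section

open MeasureTheory Set Function Filter
open _root_.Topology
open scoped ENNReal

namespace Literature.Analysis.FluidPDE

open Literature.Analysis.ODE

variable {E : Type*} [NormedAddCommGroup E] [InnerProductSpace ℝ E] [FiniteDimensional ℝ E]
  [MeasurableSpace E] [BorelSpace E]
variable {ι : Type*} [Fintype ι]

/-! ### Dyadic times -/

/-- The dyadic times `s_n = T 2^{-n}` (tops of the layers `(s_{n+1}, s_n]` exhausting `(0, T]`).
[folklore] -/
def dyadicTime (T : ℝ) (n : ℕ) : ℝ := T * (2 : ℝ)⁻¹ ^ n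

omit [Fintype ι] in
/-- `s_0 = T`. [folklore] -/
@[simp] theorem dyadicTime_zero (T : ℝ) : dyadicTime T 0 = T := by simp [dyadicTime]

/-- `s_{n+1} = s_n / 2`. [folklore] -/
theorem dyadicTime_succ (T : ℝ) (n : ℕ) : dyadicTime T (n + 1) = dyadicTime T n / 2 := by
  simp only [dyadicTime, pow_succ]; ring

/-- `2 s_{n+1} = s_n`. [folklore] -/
theorem two_mul_dyadicTime_succ (T : ℝ) (n : ℕ) : 2 * dyadicTime T (n + 1) = dyadicTime T n := by
  rw [dyadicTime_succ]; ring

/-- `s_n > 0` for `T > 0`. [folklore] -/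
theorem dyadicTime_pos {T : ℝ} (hT : 0 < T) (n : ℕ) : 0 < dyadicTime T n := by
  unfold dyadicTime; positivity

/-- `s_n ≤ T` for `T ≥ 0`. [folklore] -/
theorem dyadicTime_le {T : ℝ} (hT : 0 ≤ T) (n : ℕ) : dyadicTime T n ≤ T := by
  unfold dyadicTime
  exact mul_le_of_le_one_right hT (pow_le_one₀ (by norm_num) (by norm_num))

/-- `s_{n+1} < s_n` for `T > 0`. [folklore] -/
theorem dyadicTime_succ_lt {T : ℝ} (hT : 0 < T) (n : ℕ) : dyadicTime T (n + 1) < dyadicTime T n := by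
  rw [dyadicTime_succ]; linarith [dyadicTime_pos hT n]

/-- `s_{n+1} = (T/2) 2^{-n}` (the form of `Literature.Analysis.ODE.tsum_dyadic_rpow_le`). [folklore] -/
theorem dyadicTime_succ_eq (T : ℝ) (n : ℕ) : dyadicTime T (n + 1) = T / 2 * (2 : ℝ)⁻¹ ^ n := by
  simp only [dyadicTime, pow_succ]; ring

/-- `s_n → 0`. [folklore] -/
theorem tendsto_dyadicTime (T : ℝ) : Tendsto (dyadicTime T) atTop (𝓝 0) := by
  have h := (tendsto_pow_atTop_nhds_zero_of_lt_one (r := (2 : ℝ)⁻¹) (by norm_num)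
    (by norm_num)).const_mul T
  rw [mul_zero] at h
  exact h

/-! ### Hypothesis bundles -/

/-- **The coefficient hypotheses** (what the linear estimate uses of the principal part `v⁽ⁱ⁾` of
Coiculescu–Palasek: Prop. 3.13): `v` jointly measurable on `ℝ × E` with `‖v τ y‖ ≤ V(τ)` on
`(0, T]`, `V ≥ 0` continuous on `(0, T]`, the Kato bound `√τ V(τ) ≤ K₀` ((3.13a), `m = 0`) and the
lacunarity `∫_{t₁}^{t₂} (V² + s^{-1/2}V) ds ≤ C(1 + η log(t₂/t₁))` for `0 < t₁ ≤ t₂ ≤ T` ((3.13b) with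
slope `η = (log A)⁻¹`). [cite: CoiculescuPalasek2025, Prop. 3.13] -/
structure LacunaryCoeff (T K₀ C η : ℝ) (v : ℝ → E → E) (V : ℝ → ℝ) : Prop where
  /-- joint measurability of the coefficient -/
  meas : Measurable (uncurry v)
  /-- the slice-wise envelope -/
  bound : ∀ τ ∈ Ioc 0 T, ∀ y, ‖v τ y‖ ≤ V τ
  /-- continuity of the envelope on `(0, T]` -/
  cont : ContinuousOn V (Ioc 0 T)
  /-- non-negativity of the envelope -/
  nonneg : ∀ τ ∈ Ioc 0 T, 0 ≤ V τ
  /-- `K₀ ≥ 0` -/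
  K₀_nonneg : 0 ≤ K₀
  /-- `C ≥ 0` -/
  C_nonneg : 0 ≤ C
  /-- `η ≥ 0` -/
  η_nonneg : 0 ≤ η
  /-- (3.13a), `m = 0`: `√τ ‖v(τ)‖_∞ ≤ K₀` -/
  kato : ∀ τ ∈ Ioc 0 T, Real.sqrt τ * V τ ≤ K₀
  /-- (3.13b): lacunarity with slope `η` -/
  lacunary : ∀ t₁ t₂ : ℝ, 0 < t₁ → t₁ ≤ t₂ → t₂ ≤ T →
    ∫ s in t₁..t₂, (V s ^ 2 + s ^ (-(1 / 2 : ℝ)) * V s) ≤ C * (1 + η * Real.log (t₂ / t₁))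

/-- **The forcing hypotheses** (the sup-form weight of the space `Y` of §4.2 of Coiculescu–Palasek,
`sup_t t^{1-α}‖F(t)‖_∞`, for a forcing written as finitely many rank-one pairs): pairs `(aᵢ, bᵢ)` of
jointly measurable fields with continuous non-negative envelopes `Aᵢ, Bᵢ` on `(0, T]` and
`Σᵢ Aᵢ(τ)Bᵢ(τ) ≤ N τ^{α-1}`, `0 < α ≤ 1`. [cite: CoiculescuPalasek2025, §4.2 (space Y) and Prop. 4.1] -/
structure ForcingPairs (T α N : ℝ) (a b : ι → ℝ → E → E) (A B : ι → ℝ → ℝ) : Prop where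
  /-- `T > 0` -/
  T_pos : 0 < T
  /-- `α > 0` -/
  α_pos : 0 < α
  /-- `α ≤ 1` -/
  α_le : α ≤ 1
  /-- `N ≥ 0` -/
  N_nonneg : 0 ≤ N
  /-- joint measurability -/
  meas_a : ∀ i, Measurable (uncurry (a i))
  /-- joint measurability -/
  meas_b : ∀ i, Measurable (uncurry (b i))
  /-- slice-wise envelopes -/
  bound_a : ∀ i, ∀ τ ∈ Ioc 0 T, ∀ y, ‖a i τ y‖ ≤ A i τ
  /-- slice-wise envelopes -/
  bound_b : ∀ i, ∀ τ ∈ Ioc 0 T, ∀ y, ‖b i τ y‖ ≤ B i τ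
  /-- continuity of the envelopes -/
  cont_A : ∀ i, ContinuousOn (A i) (Ioc 0 T)
  /-- continuity of the envelopes -/
  cont_B : ∀ i, ContinuousOn (B i) (Ioc 0 T)
  /-- non-negativity -/
  A_nonneg : ∀ i, ∀ τ ∈ Ioc 0 T, 0 ≤ A i τ
  /-- non-negativity -/
  B_nonneg : ∀ i, ∀ τ ∈ Ioc 0 T, 0 ≤ B i τ
  /-- the subcritical weight: `Σᵢ AᵢBᵢ ≤ N τ^{α-1}` -/
  dom : ∀ τ ∈ Ioc 0 T, ∑ i, A i τ * B i τ ≤ N * τ ^ (α - 1)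

/-! ### Free terms, layers, and the layer problems -/

/-- **The free term from time `σ`**: `Φ_σ(t)(x) = Σᵢ B_σ(aᵢ, bᵢ)(t)(x)` — the mild form
`∫_σ^t e^{(t-τ)Δ}ℙ∇·(Σᵢ aᵢ ⊗ bᵢ) dτ` of the forcing. [cite: CoiculescuPalasek2025, proof of Prop. 4.3 (the Duhamel formula for w)] -/
def freeFrom (a b : ι → ℝ → E → E) (σ t : ℝ) (x : E) : E :=
  ∑ i, oseenDuhamel 1 σ (a i) (b i) t x

/-- **The layer free term** `Ψ_n = 𝟙_{(s_{n+1},T]} (Φ_{s_{n+1}} - Φ_{s_n})`: the forcing of the layer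
`(s_{n+1}, s_n]` propagated to later times. [cite: CoiculescuPalasek2025, proof of Prop. 4.2] -/
def layerFree (T : ℝ) (a b : ι → ℝ → E → E) (n : ℕ) : ℝ → E → E :=
  windowTrunc (dyadicTime T (n + 1)) T fun t x =>
    freeFrom a b (dyadicTime T (n + 1)) t x - freeFrom a b (dyadicTime T n) t x

/-- The coefficient truncated to the window `(s_{n+1}, T]` (bounded there). [folklore] -/
def layerCoeff (T : ℝ) (v : ℝ → E → E) (n : ℕ) : ℝ → E → E :=
  windowTrunc (dyadicTime T (n + 1)) T v

/-- **The layer solution** `w_n`: the solution on the window `(s_{n+1}, T]` of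
`w = Ψ_n - B(v, w) - B(w, v)` (`linPicardLimit`). [cite: CoiculescuPalasek2025, App. B, Prop. B.1] -/
def layerSol (T : ℝ) (v : ℝ → E → E) (a b : ι → ℝ → E → E) (n : ℕ) : ℝ → E → E :=
  linPicardLimit (dyadicTime T (n + 1)) T (layerCoeff T v n) (layerFree T a b n)

variable (E) in
/-- **The layer envelope** `φ_n(t) = C₀ N A_{s_{n+1}}[𝟙_{(-∞,s_n]} τ^{α-1}](t)
 = C₀ N ∫_{(s_{n+1}, t ∧ s_n)} (t-τ)^{-1/2} τ^{α-1} dτ`. [cite: CoiculescuPalasek2025, proof of Prop. 4.2 (term I)] -/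
def layerEnvelope (T α N : ℝ) (n : ℕ) (t : ℝ) : ℝ :=
  oseenSliceConst E * N *
    abelOp (dyadicTime T (n + 1)) ((Iic (dyadicTime T n)).indicator fun τ => τ ^ (α - 1)) t

/-! ### The Grönwall constants -/

/-- The constant of `Literature.Analysis.ODE.lacunary_gronwall_power`, chosen once. [folklore] -/
def lacunaryConst : ℝ := Classical.choose lacunary_gronwall_power

/-- `C_G > 0`. [folklore] -/
theorem lacunaryConst_pos : 0 < lacunaryConst := (Classical.choose_spec lacunary_gronwall_power).1

/-- The specification of `C_G`. [folklore] -/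
theorem lacunaryConst_spec : ∀ ⦃t₀ T : ℝ⦄ ⦃f V : ℝ → ℝ⦄ ⦃a K₀ C η : ℝ⦄, 0 < t₀ →
      ContinuousOn f (Icc t₀ T) → ContinuousOn V (Icc t₀ T) →
      (∀ t ∈ Icc t₀ T, 0 ≤ f t) → (∀ t ∈ Icc t₀ T, 0 ≤ V t) →
      0 ≤ a → 0 ≤ K₀ → 0 ≤ C → 0 ≤ η →
      (∀ s ∈ Icc t₀ T, Real.sqrt s * V s ≤ K₀) →
      (∀ t ∈ Icc t₀ T,
        ∫ s in t₀..t, (V s ^ 2 + s ^ (-(1 / 2 : ℝ)) * V s) ≤ C * (1 + η * Real.log (t / t₀))) →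
      (∀ t ∈ Icc t₀ T, f t ≤ a + ∫ s in t₀..t,
        Real.sqrt 2 * (s ^ (-(1 / 2 : ℝ)) + (t - s) ^ (-(1 / 2 : ℝ))) * V s * f s) →
      ∀ ⦃t : ℝ⦄, t ∈ Icc t₀ T →
        f t ≤ lacunaryConst * a * Real.exp (lacunaryConst * (1 + 2 * K₀) * C) *
          (t / t₀) ^ (lacunaryConst * (1 + 2 * K₀) * C * η) :=
  (Classical.choose_spec lacunary_gronwall_power).2

variable (E) in
/-- **The Grönwall exponent rate** `Λ = C_G (1 + 2·(2C₀)K₀) · ((2C₀)² + 2C₀) C`: the power loss is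
`(t/t₀)^{Λη}` (Coiculescu–Palasek: "`O((t/t')^{O(1/log A)})`"). [cite: CoiculescuPalasek2025, proof of Prop. 4.2] -/
def gronwallRate (K₀ C : ℝ) : ℝ :=
  lacunaryConst * (1 + 2 * (2 * oseenSliceConst E * K₀)) *
    (((2 * oseenSliceConst E) ^ 2 + 2 * oseenSliceConst E) * C)

variable (E) in
/-- **The layer constant** `C_* = 7 C₀ C_G e^{Λ}`. [cite: CoiculescuPalasek2025, proof of Prop. 4.2] -/
def layerConst (K₀ C : ℝ) : ℝ :=
  7 * oseenSliceConst E * lacunaryConst * Real.exp (gronwallRate E K₀ C)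

variable (E) in
/-- **The layer bound** `R_n(t) = C_* N s_{n+1}^α (t/s_{n+1})^{Λη} t^{-1/2}` (Prop. 4.2 of
Coiculescu–Palasek in forcing form, first slot, for the forcing of one dyadic layer:
`‖S(t,t')a‖_∞ ≲ t^{-1/2}(t')^{-1+α}(t/t')^{ε/2}‖a‖_Y` integrated over the layer `t' ∼ s_{n+1}`).
[cite: CoiculescuPalasek2025, Prop. 4.2] -/
def layerBound (T α N K₀ C η : ℝ) (n : ℕ) (t : ℝ) : ℝ :=
  layerConst E K₀ C * N * dyadicTime T (n + 1) ^ α *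
    (t / dyadicTime T (n + 1)) ^ (gronwallRate E K₀ C * η) * t ^ (-(1 / 2 : ℝ))

/-- `Λ ≥ 0` for `K₀, C ≥ 0`. [folklore] -/
theorem gronwallRate_nonneg {K₀ C : ℝ} (hK : 0 ≤ K₀) (hC : 0 ≤ C) : 0 ≤ gronwallRate E K₀ C := by
  have := lacunaryConst_pos.le
  have := (oseenSliceConst_pos (E := E)).le
  unfold gronwallRate; positivity

/-- `C_* > 0`. [folklore] -/
theorem layerConst_pos (K₀ C : ℝ) : 0 < layerConst E K₀ C := by
  have := lacunaryConst_pos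
  have := oseenSliceConst_pos (E := E)
  unfold layerConst; positivity

/-- `R_n(t) ≥ 0` for `t ≥ 0` (and `N ≥ 0`, `T > 0`). [folklore] -/
theorem layerBound_nonneg {T α N K₀ C η : ℝ} (hT : 0 < T) (hN : 0 ≤ N) (n : ℕ) {t : ℝ} (ht : 0 ≤ t) :
    0 ≤ layerBound E T α N K₀ C η n t := by
  have := (layerConst_pos (E := E) K₀ C).le
  have := (dyadicTime_pos hT (n + 1)).le
  unfold layerBound; positivity

/-! ### The free terms: measurability, support, envelopes -/

section Free

variable {T α N : ℝ} {a b : ι → ℝ → E → E} {A B : ι → ℝ → ℝ}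

omit [Fintype ι] in
/-- `B_σ(a,b)(t) = 0` for `t ≤ σ` (empty time integral). [folklore] -/
theorem oseenDuhamel_of_le {σ t : ℝ} (a' b' : ℝ → E → E) (h : t ≤ σ) (x : E) :
    oseenDuhamel 1 σ a' b' t x = 0 := by
  rw [oseenDuhamel_apply, Ioo_eq_empty (not_lt.2 h), Measure.restrict_empty, integral_zero_measure]

/-- `Φ_σ(t) = 0` for `t ≤ σ`. [folklore] -/
theorem freeFrom_of_le {σ t : ℝ} (h : t ≤ σ) (x : E) : freeFrom a b σ t x = 0 := by
  unfold freeFrom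
  exact Finset.sum_eq_zero fun i _ => oseenDuhamel_of_le _ _ h x

/-- Joint measurability of `Φ_σ`. [folklore] -/
theorem measurable_uncurry_freeFrom (hF : ForcingPairs T α N a b A B) (σ : ℝ) :
    Measurable (uncurry fun t x => freeFrom a b σ t x) := by
  have h : (uncurry fun t x => freeFrom a b σ t x) =
      fun q : ℝ × E => ∑ i, oseenDuhamel 1 σ (a i) (b i) q.1 q.2 := by
    funext q; rfl
  rw [h]
  exact Finset.measurable_sum _ fun i _ =>
    measurable_uncurry_oseenDuhamel_from (hF.meas_a i) (hF.meas_b i) 1 σ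

/-- Joint measurability of the layer free term. [folklore] -/
theorem measurable_uncurry_layerFree (hF : ForcingPairs T α N a b A B) (n : ℕ) :
    Measurable (uncurry (layerFree T a b n)) :=
  measurable_uncurry_windowTrunc
    ((measurable_uncurry_freeFrom hF _).sub (measurable_uncurry_freeFrom hF _))

/-- The layer free term vanishes off its window. [folklore] -/
theorem layerFree_of_not_mem (n : ℕ) {t : ℝ} (ht : t ∉ Ioc (dyadicTime T (n + 1)) T) (x : E) :
    layerFree T a b n t x = 0 :=
  windowTrunc_of_not_mem ht x

/-- On its window the layer free term is the difference of consecutive free terms. [folklore] -/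
theorem layerFree_of_mem (n : ℕ) {t : ℝ} (ht : t ∈ Ioc (dyadicTime T (n + 1)) T) (x : E) :
    layerFree T a b n t x =
      freeFrom a b (dyadicTime T (n + 1)) t x - freeFrom a b (dyadicTime T n) t x :=
  windowTrunc_of_mem ht x

omit [InnerProductSpace ℝ E] [FiniteDimensional ℝ E] [BorelSpace E] in
/-- **Integrability of the weight against the Abel kernel from time zero**:
`(t-τ)^{-1/2} τ^{α-1}` is integrable on `(σ, t)` for `0 ≤ σ` (Abel–Beta,
`Literature.Analysis.FluidPDE.setIntegral_abel_rpow_le` with `β = 1 - α ∈ [0,1)`). [folklore] -/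
theorem integrableOn_abelKernel_mul_rpow (hF : ForcingPairs T α N a b A B) {σ t : ℝ} (hσ : 0 ≤ σ) :
    IntegrableOn (fun τ => (t - τ) ^ (-(1 / 2 : ℝ)) * τ ^ (α - 1)) (Ioo σ t) := by
  rcases le_or_gt t 0 with ht | ht
  · have he : Ioo σ t = ∅ := Ioo_eq_empty fun h => absurd (hσ.trans_lt h) (not_lt.2 ht)
    rw [he]
    exact integrableOn_empty
  have h := (setIntegral_abel_rpow_le (β := 1 - α) (by linarith [hF.α_le]) (by linarith [hF.α_pos])
    ht).1
  have h' : IntegrableOn (fun τ => (t - τ) ^ (-(1 / 2 : ℝ)) * τ ^ (α - 1)) (Ioo 0 t) :=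
    h.congr (Eventually.of_forall fun τ => by rw [show -(1 - α) = α - 1 by ring])
  exact h'.mono_set (Ioo_subset_Ioo hσ le_rfl)

omit [InnerProductSpace ℝ E] [FiniteDimensional ℝ E] [BorelSpace E] in
/-- **Integrability of one pair's envelope** on `(σ, t)`, `0 ≤ σ`, `t ≤ T`: `(t-τ)^{-1/2} Aᵢ(τ)Bᵢ(τ)`
is dominated by `N (t-τ)^{-1/2} τ^{α-1}` (Abel–Beta integrable). [folklore] -/
theorem integrableOn_envelope_pair (hF : ForcingPairs T α N a b A B) (i : ι) {σ t : ℝ}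
    (hσ : 0 ≤ σ) (ht : t ≤ T) :
    IntegrableOn (fun τ => (t - τ) ^ (-(1 / 2 : ℝ)) * (A i τ * B i τ)) (Ioo σ t) := by
  have hsub : Ioo σ t ⊆ Ioc 0 T := fun τ hτ => ⟨hσ.trans_lt hτ.1, hτ.2.le.trans ht⟩
  have hdom : ∀ τ ∈ Ioo σ t, ‖(t - τ) ^ (-(1 / 2 : ℝ)) * (A i τ * B i τ)‖ ≤
      N * ((t - τ) ^ (-(1 / 2 : ℝ)) * τ ^ (α - 1)) := by
    intro τ hτ
    have hτ' := hsub hτ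
    have hk : 0 ≤ (t - τ) ^ (-(1 / 2 : ℝ)) := Real.rpow_nonneg (sub_nonneg.2 hτ.2.le) _
    have h0 : 0 ≤ A i τ * B i τ := mul_nonneg (hF.A_nonneg i τ hτ') (hF.B_nonneg i τ hτ')
    rw [norm_mul, Real.norm_of_nonneg hk, Real.norm_of_nonneg h0]
    calc (t - τ) ^ (-(1 / 2 : ℝ)) * (A i τ * B i τ)
        ≤ (t - τ) ^ (-(1 / 2 : ℝ)) * (N * τ ^ (α - 1)) := by
          refine mul_le_mul_of_nonneg_left ?_ hk
          calc A i τ * B i τ ≤ ∑ j, A j τ * B j τ :=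
                Finset.single_le_sum (fun j _ => mul_nonneg (hF.A_nonneg j τ hτ') (hF.B_nonneg j τ hτ'))
                  (Finset.mem_univ i)
            _ ≤ N * τ ^ (α - 1) := hF.dom τ hτ'
      _ = N * ((t - τ) ^ (-(1 / 2 : ℝ)) * τ ^ (α - 1)) := by ring
  refine Integrable.mono' ((integrableOn_abelKernel_mul_rpow hF hσ).const_mul N) ?_
    (ae_restrict_of_forall_mem measurableSet_Ioo hdom)
  exact ((measurable_sub_rpow_const t _).aestronglyMeasurable.restrict).mul
    ((((hF.cont_A i).mul (hF.cont_B i)).mono hsub).aestronglyMeasurable measurableSet_Ioo)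

/-- **Bound of the moved free term by the layer integral**: for `0 < σ ≤ σ'`, `t ≤ T`,
`‖Φ_σ(t)(x) - Φ_{σ'}(t)(x)‖ ≤ C₀ N ∫_{(σ, t ∧ σ')} (t-τ)^{-1/2} τ^{α-1} dτ`. [cite: CoiculescuPalasek2025, proof of Prop. 4.2 (term I)] -/
theorem norm_freeFrom_sub_freeFrom_le (hF : ForcingPairs T α N a b A B) {σ σ' t : ℝ}
    (hσ : 0 ≤ σ) (hσσ' : σ ≤ σ') (ht : t ≤ T) (x : E) :
    ‖freeFrom a b σ t x - freeFrom a b σ' t x‖ ≤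
      oseenSliceConst E * N *
        ∫ τ in Ioo σ (min t σ'), (t - τ) ^ (-(1 / 2 : ℝ)) * τ ^ (α - 1) := by
  have hC := (oseenSliceConst_pos (E := E)).le
  have hsub : Ioo σ t ⊆ Ioc 0 T := fun τ hτ => ⟨hσ.trans_lt hτ.1, hτ.2.le.trans ht⟩
  -- termwise
  have hterm : ∀ i, ‖oseenDuhamel 1 σ (a i) (b i) t x - oseenDuhamel 1 σ' (a i) (b i) t x‖ ≤
      oseenSliceConst E * ∫ τ in Ioo σ (min t σ'), (t - τ) ^ (-(1 / 2 : ℝ)) * (A i τ * B i τ) := by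
    intro i
    have h := norm_oseenDuhamel_sub_oseenDuhamel_le hσσ' (hF.meas_a i) (hF.meas_b i)
      (fun τ hτ y => hF.bound_a i τ (hsub hτ) y) (fun τ hτ y => hF.bound_b i τ (hsub hτ) y)
      (integrableOn_envelope_pair hF i hσ ht) x
    rwa [setIntegral_inter_Iic_eq_setIntegral_Ioo_min] at h
  -- sum and compare envelopes
  have hsub' : Ioo σ (min t σ') ⊆ Ioc 0 T := fun τ hτ =>
    ⟨hσ.trans_lt hτ.1, (hτ.2.trans_le (min_le_left _ _)).le.trans ht⟩
  have hIpow : IntegrableOn (fun τ => (t - τ) ^ (-(1 / 2 : ℝ)) * τ ^ (α - 1)) (Ioo σ (min t σ')) :=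
    (integrableOn_abelKernel_mul_rpow hF hσ).mono_set (Ioo_subset_Ioo le_rfl (min_le_left _ _))
  have hIi : ∀ i, IntegrableOn (fun τ => (t - τ) ^ (-(1 / 2 : ℝ)) * (A i τ * B i τ))
      (Ioo σ (min t σ')) := fun i =>
    (integrableOn_envelope_pair hF i hσ ht).mono_set (Ioo_subset_Ioo le_rfl (min_le_left _ _))
  calc ‖freeFrom a b σ t x - freeFrom a b σ' t x‖
      = ‖∑ i, (oseenDuhamel 1 σ (a i) (b i) t x - oseenDuhamel 1 σ' (a i) (b i) t x)‖ := by
        rw [freeFrom, freeFrom, Finset.sum_sub_distrib]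
    _ ≤ ∑ i, ‖oseenDuhamel 1 σ (a i) (b i) t x - oseenDuhamel 1 σ' (a i) (b i) t x‖ :=
        norm_sum_le _ _
    _ ≤ ∑ i, oseenSliceConst E *
          ∫ τ in Ioo σ (min t σ'), (t - τ) ^ (-(1 / 2 : ℝ)) * (A i τ * B i τ) :=
        Finset.sum_le_sum fun i _ => hterm i
    _ = oseenSliceConst E *
          ∫ τ in Ioo σ (min t σ'), (t - τ) ^ (-(1 / 2 : ℝ)) * ∑ i, A i τ * B i τ := by
        rw [← Finset.mul_sum, ← integral_finsetSum _ fun i _ => hIi i]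
        congr 1
        refine integral_congr_ae (Eventually.of_forall fun τ => ?_)
        simp only [Finset.mul_sum]
    _ ≤ oseenSliceConst E *
          ∫ τ in Ioo σ (min t σ'), (t - τ) ^ (-(1 / 2 : ℝ)) * (N * τ ^ (α - 1)) := by
        refine mul_le_mul_of_nonneg_left ?_ hC
        refine integral_mono_of_nonneg ?_ ?_ ?_
        · exact ae_restrict_of_forall_mem measurableSet_Ioo fun τ hτ =>
            mul_nonneg (Real.rpow_nonneg (sub_nonneg.2 (hτ.2.trans_le (min_le_left _ _)).le) _)
              (Finset.sum_nonneg fun i _ =>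
                mul_nonneg (hF.A_nonneg i τ (hsub' hτ)) (hF.B_nonneg i τ (hsub' hτ)))
        · have := hIpow.const_mul N
          refine this.congr (Eventually.of_forall fun τ => ?_)
          ring
        · exact ae_restrict_of_forall_mem measurableSet_Ioo fun τ hτ =>
            mul_le_mul_of_nonneg_left (hF.dom τ (hsub' hτ))
              (Real.rpow_nonneg (sub_nonneg.2 (hτ.2.trans_le (min_le_left _ _)).le) _)
    _ = oseenSliceConst E * N *
          ∫ τ in Ioo σ (min t σ'), (t - τ) ^ (-(1 / 2 : ℝ)) * τ ^ (α - 1) := by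
        rw [mul_assoc]
        congr 1
        rw [← integral_const_mul]
        refine integral_congr_ae (Eventually.of_forall fun τ => ?_)
        ring

/-- The layer envelope as the layer integral:
`φ_n(t) = C₀ N ∫_{(s_{n+1}, t ∧ s_n)} (t-τ)^{-1/2} τ^{α-1} dτ`. [folklore] -/
theorem layerEnvelope_eq (T α N : ℝ) (n : ℕ) (t : ℝ) :
    layerEnvelope E T α N n t = oseenSliceConst E * N *
      ∫ τ in Ioo (dyadicTime T (n + 1)) (min t (dyadicTime T n)),
        (t - τ) ^ (-(1 / 2 : ℝ)) * τ ^ (α - 1) := by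
  rw [layerEnvelope, abelOp_apply, ← setIntegral_inter_Iic_eq_setIntegral_Ioo_min]
  congr 1
  rw [← integral_indicator (measurableSet_Ioo.inter measurableSet_Iic),
    ← integral_indicator measurableSet_Ioo]
  refine integral_congr_ae (Eventually.of_forall fun τ => ?_)
  by_cases h1 : τ ∈ Ioo (dyadicTime T (n + 1)) t
  · by_cases h2 : τ ∈ Iic (dyadicTime T n)
    · rw [indicator_of_mem h1, indicator_of_mem h2, indicator_of_mem (Set.mem_inter h1 h2)]
    · rw [indicator_of_mem h1, indicator_of_notMem h2, mul_zero,
        indicator_of_notMem (fun h => h2 h.2)]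
  · rw [indicator_of_notMem h1, indicator_of_notMem (fun h => h1 h.1)]

/-- **The layer free term is bounded by the layer envelope** on its window.
[cite: CoiculescuPalasek2025, proof of Prop. 4.2 (term I)] -/
theorem norm_layerFree_le (hF : ForcingPairs T α N a b A B) (n : ℕ) {t : ℝ}
    (ht : t ∈ Ioc (dyadicTime T (n + 1)) T) (x : E) :
    ‖layerFree T a b n t x‖ ≤ layerEnvelope E T α N n t := by
  rw [layerFree_of_mem n ht, layerEnvelope_eq]
  exact norm_freeFrom_sub_freeFrom_le hF (dyadicTime_pos hF.T_pos _).le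
    (dyadicTime_succ_lt hF.T_pos n).le ht.2 x

/-- `√t φ_n(t) ≤ 7 C₀ N s_{n+1}^α` for `t ∈ [s_{n+1}, T]`
(`Literature.Analysis.ODE.sqrt_mul_setIntegral_layer_le`). [cite: CoiculescuPalasek2025, proof of Prop. 4.2 (term I)] -/
theorem sqrt_mul_layerEnvelope_le (hF : ForcingPairs T α N a b A B) (n : ℕ) {t : ℝ}
    (ht : dyadicTime T (n + 1) ≤ t) :
    Real.sqrt t * layerEnvelope E T α N n t ≤
      7 * oseenSliceConst E * N * dyadicTime T (n + 1) ^ α := by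
  have hC := (oseenSliceConst_pos (E := E)).le
  rw [layerEnvelope_eq, ← two_mul_dyadicTime_succ T n]
  have h := sqrt_mul_setIntegral_layer_le hF.α_le (dyadicTime_pos hF.T_pos (n + 1)) ht
  calc Real.sqrt t * (oseenSliceConst E * N *
        ∫ τ in Ioo (dyadicTime T (n + 1)) (min t (2 * dyadicTime T (n + 1))),
          (t - τ) ^ (-(1 / 2 : ℝ)) * τ ^ (α - 1))
      = oseenSliceConst E * N * (Real.sqrt t *
        ∫ τ in Ioo (dyadicTime T (n + 1)) (min t (2 * dyadicTime T (n + 1))),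
          (t - τ) ^ (-(1 / 2 : ℝ)) * τ ^ (α - 1)) := by ring
    _ ≤ oseenSliceConst E * N * (7 * dyadicTime T (n + 1) ^ α) :=
        mul_le_mul_of_nonneg_left h (mul_nonneg hC hF.N_nonneg)
    _ = 7 * oseenSliceConst E * N * dyadicTime T (n + 1) ^ α := by ring

/-- The layer envelope is continuous on `[s_{n+1}, T]` (`continuousOn_abelOp`). [folklore] -/
theorem continuousOn_layerEnvelope (hF : ForcingPairs T α N a b A B) (n : ℕ) :
    ContinuousOn (layerEnvelope E T α N n) (Icc (dyadicTime T (n + 1)) T) := by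
  have hs : 0 < dyadicTime T (n + 1) := dyadicTime_pos hF.T_pos _
  unfold layerEnvelope
  refine continuousOn_const.mul (continuousOn_abelOp (M := dyadicTime T (n + 1) ^ (α - 1)) ?_ ?_)
  · have hm : Measurable fun τ : ℝ => τ ^ (α - 1) := measurable_id.pow_const _
    exact (hm.indicator measurableSet_Iic).aestronglyMeasurable
  · intro τ hτ
    by_cases h : τ ∈ Iic (dyadicTime T n)
    · rw [indicator_of_mem h, abs_of_nonneg (Real.rpow_nonneg (hs.le.trans hτ.1.le) _)]
      exact Real.rpow_le_rpow_of_nonpos hs hτ.1.le (by linarith [hF.α_le])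
    · rw [indicator_of_notMem h, abs_zero]
      exact Real.rpow_nonneg hs.le _

/-- The layer envelope is non-negative. [folklore] -/
theorem layerEnvelope_nonneg (hF : ForcingPairs T α N a b A B) (n : ℕ) (t : ℝ) :
    0 ≤ layerEnvelope E T α N n t := by
  have hC := (oseenSliceConst_pos (E := E)).le
  have hs : 0 < dyadicTime T (n + 1) := dyadicTime_pos hF.T_pos _
  unfold layerEnvelope
  refine mul_nonneg (mul_nonneg hC hF.N_nonneg) (abelOp_nonneg fun τ hτ => ?_)
  by_cases h : τ ∈ Iic (dyadicTime T n)
  · rw [indicator_of_mem h]; exact Real.rpow_nonneg (hs.le.trans hτ.1.le) _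
  · rw [indicator_of_notMem h]

/-- A crude global bound of the layer free term (for the window construction): on the window,
`‖Ψ_n(t)(x)‖ ≤ C₀ N s_{n+1}^{α-1} · 2√T`. [folklore] -/
theorem norm_layerFree_le_const (hF : ForcingPairs T α N a b A B) (n : ℕ) (t : ℝ) (x : E) :
    ‖layerFree T a b n t x‖ ≤
      oseenSliceConst E * N * (dyadicTime T (n + 1) ^ (α - 1) * (2 * Real.sqrt T)) := by
  have hC := (oseenSliceConst_pos (E := E)).le
  have hs : 0 < dyadicTime T (n + 1) := dyadicTime_pos hF.T_pos _
  by_cases ht : t ∈ Ioc (dyadicTime T (n + 1)) T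
  · refine (norm_layerFree_le hF n ht x).trans ?_
    rw [layerEnvelope_eq]
    refine mul_le_mul_of_nonneg_left ?_ (mul_nonneg hC hF.N_nonneg)
    -- `∫_{(s, t ∧ s')} k τ^{α-1} ≤ s^{α-1} ∫_{(s,t)} k = s^{α-1} 2√(t-s) ≤ s^{α-1} 2√T`
    have hk : IntegrableOn (fun τ : ℝ => (t - τ) ^ (-(1 / 2 : ℝ))) (Ioo (dyadicTime T (n + 1)) t) :=
      integrableOn_sub_rpow_Ioo (by norm_num)
    calc ∫ τ in Ioo (dyadicTime T (n + 1)) (min t (dyadicTime T n)),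
          (t - τ) ^ (-(1 / 2 : ℝ)) * τ ^ (α - 1)
        ≤ ∫ τ in Ioo (dyadicTime T (n + 1)) t, (t - τ) ^ (-(1 / 2 : ℝ)) * τ ^ (α - 1) := by
          refine setIntegral_mono_set ?_ ?_ (Ioo_subset_Ioo le_rfl (min_le_left _ _)).eventuallyLE
          · refine integrableOn_abelKernel_mul (M := dyadicTime T (n + 1) ^ (α - 1)) ?_ fun τ hτ => ?_
            · exact ((continuousOn_id.rpow_const fun τ hτ => Or.inl (hs.trans hτ.1).ne').aestronglyMeasurable
                measurableSet_Ioo)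
            · rw [abs_of_nonneg (Real.rpow_nonneg (hs.le.trans hτ.1.le) _)]
              exact Real.rpow_le_rpow_of_nonpos hs hτ.1.le (by linarith [hF.α_le])
          · exact ae_restrict_of_forall_mem measurableSet_Ioo fun τ hτ =>
              mul_nonneg (Real.rpow_nonneg (sub_nonneg.2 hτ.2.le) _)
                (Real.rpow_nonneg (hs.le.trans hτ.1.le) _)
      _ ≤ ∫ τ in Ioo (dyadicTime T (n + 1)) t,
            (t - τ) ^ (-(1 / 2 : ℝ)) * dyadicTime T (n + 1) ^ (α - 1) := by
          refine integral_mono_of_nonneg ?_ (hk.mul_const _) ?_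
          · exact ae_restrict_of_forall_mem measurableSet_Ioo fun τ hτ =>
              mul_nonneg (Real.rpow_nonneg (sub_nonneg.2 hτ.2.le) _)
                (Real.rpow_nonneg (hs.le.trans hτ.1.le) _)
          · exact ae_restrict_of_forall_mem measurableSet_Ioo fun τ hτ =>
              mul_le_mul_of_nonneg_left
                (Real.rpow_le_rpow_of_nonpos hs hτ.1.le (by linarith [hF.α_le]))
                (Real.rpow_nonneg (sub_nonneg.2 hτ.2.le) _)
      _ = dyadicTime T (n + 1) ^ (α - 1) * (2 * Real.sqrt (t - dyadicTime T (n + 1))) := by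
          rw [integral_mul_const, setIntegral_Ioo_sub_rpow_neg_half ht.1.le, ← Real.sqrt_eq_rpow]
          ring
      _ ≤ dyadicTime T (n + 1) ^ (α - 1) * (2 * Real.sqrt T) := by
          gcongr
          linarith [ht.2, hs.le]
  · rw [layerFree_of_not_mem n ht x, norm_zero]
    have := hF.T_pos.le
    have := hF.N_nonneg
    positivity

end Free

/-! ### The layer coefficient -/

section Coeff

variable {T K₀ C η : ℝ} {v : ℝ → E → E} {V : ℝ → ℝ}

omit [InnerProductSpace ℝ E] [FiniteDimensional ℝ E] [BorelSpace E] in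
/-- Joint measurability of the layer coefficient. [folklore] -/
theorem measurable_uncurry_layerCoeff (hv : LacunaryCoeff T K₀ C η v V) (n : ℕ) :
    Measurable (uncurry (layerCoeff T v n)) :=
  measurable_uncurry_windowTrunc hv.meas

omit [InnerProductSpace ℝ E] [FiniteDimensional ℝ E] [BorelSpace E] in
/-- The layer coefficient is bounded by the envelope on the window and vanishes elsewhere.
[folklore] -/
theorem norm_layerCoeff_le_envelope (hv : LacunaryCoeff T K₀ C η v V) (hT : 0 < T) (n : ℕ)
    {τ : ℝ} (hτ : τ ∈ Ioc (dyadicTime T (n + 1)) T) (y : E) : ‖layerCoeff T v n τ y‖ ≤ V τ := by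
  rw [layerCoeff, windowTrunc_of_mem hτ]
  exact hv.bound τ ⟨(dyadicTime_pos hT _).trans hτ.1, hτ.2⟩ y

omit [InnerProductSpace ℝ E] [FiniteDimensional ℝ E] [BorelSpace E] in
/-- A global bound of the layer coefficient (the envelope is continuous on the compact window).
[folklore] -/
theorem exists_norm_layerCoeff_le (hv : LacunaryCoeff T K₀ C η v V) (hT : 0 < T) (n : ℕ) :
    ∃ M : ℝ, 0 ≤ M ∧ ∀ τ y, ‖layerCoeff T v n τ y‖ ≤ M := by
  have hs : 0 < dyadicTime T (n + 1) := dyadicTime_pos hT _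
  have hc : ContinuousOn V (Icc (dyadicTime T (n + 1)) T) :=
    hv.cont.mono fun τ hτ => ⟨hs.trans_le hτ.1, hτ.2⟩
  obtain ⟨M, hM⟩ := isCompact_Icc.exists_bound_of_continuousOn hc
  refine ⟨|M|, abs_nonneg M, fun τ y => ?_⟩
  by_cases hτ : τ ∈ Ioc (dyadicTime T (n + 1)) T
  · calc ‖layerCoeff T v n τ y‖ ≤ V τ := norm_layerCoeff_le_envelope hv hT n hτ y
      _ ≤ ‖V τ‖ := Real.le_norm_self _
      _ ≤ M := hM τ (Ioc_subset_Icc_self hτ)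
      _ ≤ |M| := le_abs_self M
  · rw [layerCoeff, windowTrunc_of_not_mem hτ y, norm_zero]
    exact abs_nonneg M

end Coeff

/-! ### The Grönwall domination on one layer -/

section Gronwall

variable {T α N K₀ C η : ℝ} {a b : ι → ℝ → E → E} {A B : ι → ℝ → ℝ} {v : ℝ → E → E} {V : ℝ → ℝ}

/-- **Prop. 4.2 (first slot) on one dyadic layer, as a domination of sub-solutions.** Every
continuous non-negative `B` on `[s_{n+1}, T]` with
`B(t) ≤ φ_n(t) + 2C₀ A_{s_{n+1}}[V B](t)` satisfies `B(t) ≤ R_n(t)`: multiply by `√t`, use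
`√t φ_n ≤ 7C₀N s_{n+1}^α` (`sqrt_mul_layerEnvelope_le`) and the kernel comparison
`√(t/τ)(t-τ)^{-1/2} ≤ √2(τ^{-1/2} + (t-τ)^{-1/2})` to put `f = √t B` in the form of the lacunary
fractional Grönwall inequality (`lacunaryConst_spec` = Lemma B.3 + (3.13a,b)) with coefficient
`2C₀V` (Kato constant `2C₀K₀`, lacunarity constant `((2C₀)²+2C₀)C`).
[cite: CoiculescuPalasek2025, proof of Prop. 4.2] -/
theorem le_layerBound_of_subsolution (hF : ForcingPairs T α N a b A B)
    (hv : LacunaryCoeff T K₀ C η v V) (n : ℕ) {Bf : ℝ → ℝ}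
    (hBc : ContinuousOn Bf (Icc (dyadicTime T (n + 1)) T))
    (hB0 : ∀ t ∈ Icc (dyadicTime T (n + 1)) T, 0 ≤ Bf t)
    (hB : ∀ t ∈ Icc (dyadicTime T (n + 1)) T, Bf t ≤ layerEnvelope E T α N n t +
      2 * oseenSliceConst E * abelOp (dyadicTime T (n + 1)) (fun τ => V τ * Bf τ) t) :
    ∀ t ∈ Icc (dyadicTime T (n + 1)) T, Bf t ≤ layerBound E T α N K₀ C η n t := by
  set σ := dyadicTime T (n + 1) with hσdef
  have hσ : 0 < σ := dyadicTime_pos hF.T_pos _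
  have hC₀ := oseenSliceConst_pos (E := E)
  set L : ℝ := 2 * oseenSliceConst E with hL
  have hL0 : 0 ≤ L := by positivity
  have hLne : L ≠ 0 := ne_of_gt (by positivity)
  have hsub : Icc σ T ⊆ Ioc 0 T := fun τ hτ => ⟨hσ.trans_le hτ.1, hτ.2⟩
  -- the data of the Grönwall lemma
  set f : ℝ → ℝ := fun t => Real.sqrt t * Bf t with hf
  set V' : ℝ → ℝ := fun t => L * V t with hV'
  set a₀ : ℝ := 7 * oseenSliceConst E * N * σ ^ α with ha₀
  have hfc : ContinuousOn f (Icc σ T) := (Real.continuous_sqrt.continuousOn).mul hBc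
  have hVc : ContinuousOn V (Icc σ T) := hv.cont.mono hsub
  have hV'c : ContinuousOn V' (Icc σ T) := continuousOn_const.mul hVc
  have hf0 : ∀ t ∈ Icc σ T, 0 ≤ f t := fun t ht => mul_nonneg (Real.sqrt_nonneg _) (hB0 t ht)
  have hV0 : ∀ t ∈ Icc σ T, 0 ≤ V t := fun t ht => hv.nonneg t (hsub ht)
  have hV'0 : ∀ t ∈ Icc σ T, 0 ≤ V' t := fun t ht => mul_nonneg hL0 (hV0 t ht)
  have ha₀0 : 0 ≤ a₀ := by
    have := hF.N_nonneg; have := (Real.rpow_pos_of_pos hσ α).le; positivity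
  have hkato : ∀ s ∈ Icc σ T, Real.sqrt s * V' s ≤ L * K₀ := by
    intro s hs
    calc Real.sqrt s * V' s = L * (Real.sqrt s * V s) := by simp only [hV']; ring
      _ ≤ L * K₀ := mul_le_mul_of_nonneg_left (hv.kato s (hsub hs)) hL0
  have hlac : ∀ t ∈ Icc σ T, ∫ s in σ..t, (V' s ^ 2 + s ^ (-(1 / 2 : ℝ)) * V' s) ≤
      (L ^ 2 + L) * C * (1 + η * Real.log (t / σ)) := by
    intro t ht
    have hle : σ ≤ t := ht.1
    have hVi : IntervalIntegrable (fun s => V s ^ 2 + s ^ (-(1 / 2 : ℝ)) * V s) volume σ t := by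
      refine ContinuousOn.intervalIntegrable ?_
      rw [uIcc_of_le hle]
      have hVt : ContinuousOn V (Icc σ t) := hVc.mono (Icc_subset_Icc le_rfl ht.2)
      have hpow : ContinuousOn (fun s : ℝ => s ^ (-(1 / 2 : ℝ))) (Icc σ t) := fun s hs =>
        (Real.continuousAt_rpow_const _ _ (Or.inl (hσ.trans_le hs.1).ne')).continuousWithinAt
      exact (hVt.pow 2).add (hpow.mul hVt)
    have hpt : ∀ s ∈ Icc σ t, V' s ^ 2 + s ^ (-(1 / 2 : ℝ)) * V' s ≤
        (L ^ 2 + L) * (V s ^ 2 + s ^ (-(1 / 2 : ℝ)) * V s) := by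
      intro s hs
      have hs' : s ∈ Icc σ T := ⟨hs.1, hs.2.trans ht.2⟩
      have h1 : 0 ≤ V s ^ 2 := sq_nonneg _
      have h2 : 0 ≤ s ^ (-(1 / 2 : ℝ)) * V s :=
        mul_nonneg (Real.rpow_nonneg (hσ.le.trans hs.1) _) (hV0 s hs')
      simp only [hV']
      nlinarith [sq_nonneg L]
    calc ∫ s in σ..t, (V' s ^ 2 + s ^ (-(1 / 2 : ℝ)) * V' s)
        ≤ ∫ s in σ..t, (L ^ 2 + L) * (V s ^ 2 + s ^ (-(1 / 2 : ℝ)) * V s) := by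
          refine intervalIntegral.integral_mono_on hle ?_ (hVi.const_mul _) hpt
          refine ContinuousOn.intervalIntegrable ?_
          rw [uIcc_of_le hle]
          have hVt : ContinuousOn V' (Icc σ t) := hV'c.mono (Icc_subset_Icc le_rfl ht.2)
          have hpow : ContinuousOn (fun s : ℝ => s ^ (-(1 / 2 : ℝ))) (Icc σ t) := fun s hs =>
            (Real.continuousAt_rpow_const _ _ (Or.inl (hσ.trans_le hs.1).ne')).continuousWithinAt
          exact (hVt.pow 2).add (hpow.mul hVt)
      _ = (L ^ 2 + L) * ∫ s in σ..t, (V s ^ 2 + s ^ (-(1 / 2 : ℝ)) * V s) :=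
          intervalIntegral.integral_const_mul _ _
      _ ≤ (L ^ 2 + L) * (C * (1 + η * Real.log (t / σ))) :=
          mul_le_mul_of_nonneg_left (hv.lacunary σ t hσ hle ht.2) (by positivity)
      _ = (L ^ 2 + L) * C * (1 + η * Real.log (t / σ)) := by ring
  -- the Volterra inequality for `f`
  have hineq : ∀ t ∈ Icc σ T, f t ≤ a₀ + ∫ s in σ..t,
      Real.sqrt 2 * (s ^ (-(1 / 2 : ℝ)) + (t - s) ^ (-(1 / 2 : ℝ))) * V' s * f s := by
    intro t ht
    have hle : σ ≤ t := ht.1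
    have ht0 : 0 < t := hσ.trans_le hle
    -- bounds of `V Bf` on the window
    obtain ⟨M, hM⟩ := exists_abs_le_of_continuousOn_Icc (hVc.mul hBc) (t₀ := σ) (T := T)
    have hVBm : AEStronglyMeasurable (fun τ => V τ * Bf τ) (volume.restrict (Ioo σ t)) :=
      ((hVc.mul hBc).mono fun τ hτ => ⟨hτ.1.le, hτ.2.le.trans ht.2⟩).aestronglyMeasurable
        measurableSet_Ioo
    -- `√t · A[V Bf](t) ≤ ∫ √2 (s^{-1/2} + (t-s)^{-1/2}) V f`
    have hcomp : Real.sqrt t * abelOp σ (fun τ => V τ * Bf τ) t ≤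
        ∫ s in Ioo σ t, Real.sqrt 2 * (s ^ (-(1 / 2 : ℝ)) + (t - s) ^ (-(1 / 2 : ℝ))) * V s * f s := by
      rw [abelOp_apply, ← integral_const_mul]
      -- integrability of the right-hand side
      have hI : IntegrableOn (fun s => Real.sqrt 2 * (s ^ (-(1 / 2 : ℝ)) + (t - s) ^ (-(1 / 2 : ℝ))) *
          V s * f s) (Ioo σ t) := by
        have h1 : IntegrableOn (fun s => (t - s) ^ (-(1 / 2 : ℝ)) * (V s * f s)) (Ioo σ t) := by
          refine integrableOn_abelKernel_mul (M := M * Real.sqrt T) ?_ fun τ hτ => ?_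
          · exact ((hVc.mul hfc).mono fun τ hτ => ⟨hτ.1.le, hτ.2.le.trans ht.2⟩).aestronglyMeasurable
              measurableSet_Ioo
          · have hτ' : τ ∈ Icc σ T := ⟨hτ.1.le, hτ.2.le.trans ht.2⟩
            simp only [hf]
            rw [show V τ * (Real.sqrt τ * Bf τ) = Real.sqrt τ * (V τ * Bf τ) by ring, abs_mul,
              abs_of_nonneg (Real.sqrt_nonneg _), mul_comm]
            exact mul_le_mul (hM τ hτ') (Real.sqrt_le_sqrt hτ'.2) (Real.sqrt_nonneg _)
              ((abs_nonneg _).trans (hM τ hτ'))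
        have h2 : IntegrableOn (fun s => s ^ (-(1 / 2 : ℝ)) * (V s * f s)) (Ioo σ t) := by
          have hc : ContinuousOn (fun s => s ^ (-(1 / 2 : ℝ)) * (V s * f s)) (Icc σ t) := by
            have hpow : ContinuousOn (fun s : ℝ => s ^ (-(1 / 2 : ℝ))) (Icc σ t) := fun s hs =>
              (Real.continuousAt_rpow_const _ _ (Or.inl (hσ.trans_le hs.1).ne')).continuousWithinAt
            exact hpow.mul ((hVc.mul hfc).mono (Icc_subset_Icc le_rfl ht.2))
          exact (hc.integrableOn_Icc).mono_set Ioo_subset_Icc_self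
        have h := (h2.add h1).const_mul (Real.sqrt 2)
        refine h.congr (Eventually.of_forall fun s => ?_)
        simp only [Pi.add_apply]
        ring
      refine integral_mono_of_nonneg ?_ hI ?_
      · refine ae_restrict_of_forall_mem measurableSet_Ioo fun s hs => ?_
        have hs' : s ∈ Icc σ T := ⟨hs.1.le, hs.2.le.trans ht.2⟩
        exact mul_nonneg (Real.sqrt_nonneg _) (mul_nonneg (Real.rpow_nonneg (sub_nonneg.2 hs.2.le) _)
          (mul_nonneg (hV0 s hs') (hB0 s hs')))
      · refine ae_restrict_of_forall_mem measurableSet_Ioo fun s hs => ?_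
        have hs' : s ∈ Icc σ T := ⟨hs.1.le, hs.2.le.trans ht.2⟩
        have hs0 : 0 < s := hσ.trans hs.1
        have hk := sqrt_div_mul_rpow_neg_half_le hs0 hs.2
        have hVB : 0 ≤ V s * Bf s := mul_nonneg (hV0 s hs') (hB0 s hs')
        -- `√t k V Bf = (√(t/s) k) · V · (√s Bf)`
        have hsq : Real.sqrt t = Real.sqrt (t / s) * Real.sqrt s := by
          rw [← Real.sqrt_mul (div_nonneg ht0.le hs0.le), div_mul_cancel₀ t hs0.ne']
        calc Real.sqrt t * ((t - s) ^ (-(1 / 2 : ℝ)) * (V s * Bf s))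
            = (Real.sqrt (t / s) * (t - s) ^ (-(1 / 2 : ℝ))) * V s * (Real.sqrt s * Bf s) := by
              rw [hsq]; ring
          _ ≤ (Real.sqrt 2 * (s ^ (-(1 / 2 : ℝ)) + (t - s) ^ (-(1 / 2 : ℝ)))) * V s *
                (Real.sqrt s * Bf s) :=
              mul_le_mul_of_nonneg_right (mul_le_mul_of_nonneg_right hk (hV0 s hs'))
                (mul_nonneg (Real.sqrt_nonneg _) (hB0 s hs'))
          _ = Real.sqrt 2 * (s ^ (-(1 / 2 : ℝ)) + (t - s) ^ (-(1 / 2 : ℝ))) * V s * f s := by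
              simp only [hf]
    -- assemble, then convert the set integral into an interval integral
    have hconv : ∫ s in Ioo σ t, Real.sqrt 2 * (s ^ (-(1 / 2 : ℝ)) + (t - s) ^ (-(1 / 2 : ℝ))) *
        V s * f s = ∫ s in σ..t, Real.sqrt 2 * (s ^ (-(1 / 2 : ℝ)) + (t - s) ^ (-(1 / 2 : ℝ))) *
          V' s * (f s / L) := by
      rw [intervalIntegral.integral_of_le hle, integral_Ioc_eq_integral_Ioo]
      refine integral_congr_ae (Eventually.of_forall fun s => ?_)
      simp only [hV']
      field_simp
    calc f t = Real.sqrt t * Bf t := rfl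
      _ ≤ Real.sqrt t * (layerEnvelope E T α N n t +
            L * abelOp σ (fun τ => V τ * Bf τ) t) :=
          mul_le_mul_of_nonneg_left (hB t ht) (Real.sqrt_nonneg _)
      _ = Real.sqrt t * layerEnvelope E T α N n t +
            L * (Real.sqrt t * abelOp σ (fun τ => V τ * Bf τ) t) := by ring
      _ ≤ a₀ + L * ∫ s in Ioo σ t, Real.sqrt 2 * (s ^ (-(1 / 2 : ℝ)) + (t - s) ^ (-(1 / 2 : ℝ))) *
            V s * f s :=
          add_le_add (sqrt_mul_layerEnvelope_le hF n hle) (mul_le_mul_of_nonneg_left hcomp hL0)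
      _ = a₀ + ∫ s in σ..t, Real.sqrt 2 * (s ^ (-(1 / 2 : ℝ)) + (t - s) ^ (-(1 / 2 : ℝ))) *
            V' s * f s := by
          rw [hconv, ← intervalIntegral.integral_const_mul]
          congr 1
          refine intervalIntegral.integral_congr fun s _ => ?_
          simp only [hV']
          field_simp
  -- apply the lacunary Grönwall inequality
  intro t ht
  have hle : σ ≤ t := ht.1
  have ht0 : 0 < t := hσ.trans_le hle
  have hG := lacunaryConst_spec hσ hfc hV'c hf0 hV'0 ha₀0 (mul_nonneg hL0 hv.K₀_nonneg)
    (by have := hv.C_nonneg; positivity) hv.η_nonneg hkato hlac hineq ht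
  -- `Bf t = f t / √t`
  have hst : 0 < Real.sqrt t := Real.sqrt_pos.2 ht0
  have hBf : Bf t = f t * t ^ (-(1 / 2 : ℝ)) := by
    simp only [hf]
    rw [rpow_neg_half_eq_inv_sqrt ht0.le, mul_comm (Real.sqrt t), mul_assoc,
      mul_inv_cancel₀ hst.ne', mul_one]
  rw [hBf, layerBound]
  have hrate : lacunaryConst * (1 + 2 * (L * K₀)) * ((L ^ 2 + L) * C) = gronwallRate E K₀ C := by
    simp only [gronwallRate, hL]
  refine (mul_le_mul_of_nonneg_right hG (Real.rpow_nonneg ht0.le _)).trans (le_of_eq ?_)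
  rw [hrate]
  simp only [ha₀, layerConst, hσdef]
  ring

end Gronwall

/-! ### The layer solutions -/

section Layer

variable {T α N K₀ C η : ℝ} {a b : ι → ℝ → E → E} {A B : ι → ℝ → ℝ} {v : ℝ → E → E} {V : ℝ → ℝ}

/-- Joint measurability of the layer solution. [folklore] -/
theorem measurable_uncurry_layerSol (hF : ForcingPairs T α N a b A B)
    (hv : LacunaryCoeff T K₀ C η v V) (n : ℕ) : Measurable (uncurry (layerSol T v a b n)) := by
  obtain ⟨Mv, -, hMv⟩ := exists_norm_layerCoeff_le hv hF.T_pos n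
  exact measurable_uncurry_linPicardLimit (measurable_uncurry_layerCoeff hv n) hMv
    (measurable_uncurry_layerFree hF n) (norm_layerFree_le_const hF n)

/-- The layer solution vanishes off its window. [folklore] -/
theorem layerSol_of_not_mem (hF : ForcingPairs T α N a b A B) (hv : LacunaryCoeff T K₀ C η v V)
    (n : ℕ) {t : ℝ} (ht : t ∉ Ioc (dyadicTime T (n + 1)) T) (x : E) : layerSol T v a b n t x = 0 := by
  obtain ⟨Mv, -, hMv⟩ := exists_norm_layerCoeff_le hv hF.T_pos n
  exact linPicardLimit_eq_zero_of_not_mem (measurable_uncurry_layerCoeff hv n) hMv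
    (measurable_uncurry_layerFree hF n) (norm_layerFree_le_const hF n) ht x

/-- **The layer solution solves the layer problem** on its window:
`w_n(t)(x) = Ψ_n(t)(x) - L_{s_{n+1}}[v_n](w_n)(t)(x)`. [cite: CoiculescuPalasek2025, App. B, Prop. B.1] -/
theorem layerSol_eq (hF : ForcingPairs T α N a b A B) (hv : LacunaryCoeff T K₀ C η v V) (n : ℕ)
    {t : ℝ} (ht : t ∈ Ioc (dyadicTime T (n + 1)) T) (x : E) :
    layerSol T v a b n t x = layerFree T a b n t x -
      linOseen (dyadicTime T (n + 1)) (layerCoeff T v n) (layerSol T v a b n) t x := by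
  obtain ⟨Mv, -, hMv⟩ := exists_norm_layerCoeff_le hv hF.T_pos n
  exact linPicardLimit_eq (measurable_uncurry_layerCoeff hv n) hMv
    (measurable_uncurry_layerFree hF n) (norm_layerFree_le_const hF n) ht x

/-- A global bound of the layer solution. [folklore] -/
theorem exists_norm_layerSol_le (hF : ForcingPairs T α N a b A B) (hv : LacunaryCoeff T K₀ C η v V)
    (n : ℕ) : ∃ M : ℝ, ∀ t x, ‖layerSol T v a b n t x‖ ≤ M := by
  obtain ⟨Mv, -, hMv⟩ := exists_norm_layerCoeff_le hv hF.T_pos n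
  exact ⟨_, norm_linPicardLimit_le (measurable_uncurry_layerCoeff hv n) hMv
    (measurable_uncurry_layerFree hF n) (norm_layerFree_le_const hF n)⟩

/-- **The layer bound (Prop. 4.2, first slot, on one layer)**: `‖w_n(t)(x)‖ ≤ R_n(t)` for
`t ∈ (s_{n+1}, T]`. [cite: CoiculescuPalasek2025, Prop. 4.2] -/
theorem norm_layerSol_le (hF : ForcingPairs T α N a b A B) (hv : LacunaryCoeff T K₀ C η v V) (n : ℕ)
    {t : ℝ} (ht : t ∈ Ioc (dyadicTime T (n + 1)) T) (x : E) :
    ‖layerSol T v a b n t x‖ ≤ layerBound E T α N K₀ C η n t := by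
  have hs : 0 < dyadicTime T (n + 1) := dyadicTime_pos hF.T_pos _
  obtain ⟨Mv, -, hMv⟩ := exists_norm_layerCoeff_le hv hF.T_pos n
  refine norm_linPicardLimit_le_of_dominates (measurable_uncurry_layerCoeff hv n) hMv
    (measurable_uncurry_layerFree hF n) (norm_layerFree_le_const hF n)
    (continuousOn_layerEnvelope hF n) (hv.cont.mono fun τ hτ => ⟨hs.trans_le hτ.1, hτ.2⟩)
    (fun τ _ => layerEnvelope_nonneg hF n τ) (fun τ hτ => hv.nonneg τ ⟨hs.trans_le hτ.1, hτ.2⟩)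
    (fun τ hτ y => norm_layerFree_le hF n hτ y)
    (fun τ hτ y => norm_layerCoeff_le_envelope hv hF.T_pos n hτ y)
    (fun Bf => le_layerBound_of_subsolution hF hv n (Bf := Bf)) ht x

end Layer

end Literature.Analysis.FluidPDE
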